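import Literature.NumberTheory.Automorphic.AutomorphicQuotientSpectralExpansion
import Literature.NumberTheory.Automorphic.AutomorphicQuotientDiagonalTracePolar
import Literature.Analysis.OperatorTheory.HilbertSchmidtComposition
import HarnessLib

/-!
# The χ-expansion of the diagonal trace in complex form: `θ(g ⋆ h^*) = Tr R(g ⋆ h^*) = Σ_{[π]} m(π) Tr(π(g) π(h)^*)`
(Rogawski (1990), §14.5 p. 237: "`T_{G′}(f′)` is the trace of `ρ(f′)` on `L(G′)` … `= Σ_{π′} m(π′) tr π′(f′)`";
Gelbart (1975), (9.11), Lemma 10.6, (10.12)–(10.14); Reed–Simon I, Thm. VI.22 (e), VI.24)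

Topic `NumberTheory/Automorphic`; namespace `Literature.NumberTheory.Automorphic` (dot notation on `AdelicGroupData`, sub-namespace
`UnitaryGroup`) and `ContRepresentation` for the generic block lemma (the tree's namespace of `ClosedSubrep`). THEOREMS ONLY (no
definition, no named fact, no instance or instance attribute). Continuation of `AutomorphicQuotientSpectralExpansion` (CONE form
`θ(f ⋆ f^*) = Σ_c m(rep c) · Σ_k ‖R(f) e^{rep c}_k‖²` in `[0, ∞]`) and `AutomorphicQuotientDiagonalTracePolar` (`Σ_i ⟪R(h) e_i, R(g) e_i⟫
= θ(g ⋆ h^*)`), combined into the COMPLEX, convergent statements a consumer of "`Tr ρ(f′) = Σ_{π′} m(π′) tr π′(f′)`" reads. Setting: compact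
automorphic quotient `X = G(𝔸_K) ⧸ (A_G · G(K))`, `θ = 𝒢.diagTrace μ ρ ν`, `R = rightRegular`, `g, h ∈ C_c(G(𝔸_K))`, `F = g ⋆ h^*` pointwise.

* `ContRepresentation.ClosedSubrep.tsum_inner_integratedOperator_eq_of_areUnitarilyEquivalent` (any unitary strongly continuous `π`):
  **the Hilbert–Schmidt PAIRING of the blocks `π(g)|_W`, `π(h)|_W` depends only on the unitary class of `W`** (and not on the basis) —
  complex twin of `tsum_enorm_sq_integratedOperator_eq_of_areUnitarilyEquivalent`;
* `AdelicGroupData.summable_norm_sq_integratedOperator_rightRegular[_of_orthonormal]`, `diagTrace_hasSum_inner_of_hilbertBasis` — `R(f)`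
  is Hilbert–Schmidt along EVERY Hilbert basis ∕ orthonormal family of `L²(X, μ)` (bases of `L²` are countable, `AutomorphicL2Separable`);
* `AdelicGroupData.diagTrace_hasSum_inner_integratedOperator_self` — **`θ(F) = Σ_i ⟪e_i, R(F) e_i⟫ = Tr R(F)`** LITERALLY, along every
  Hilbert basis (`R(g ⋆ h^*) = R(g) R(h)^†`: `integratedOperator_comp_integratedOperator`, `adjoint_integratedOperator`; adjoint form of
  the pairing `hasSum_inner_apply_apply_and_adjoint`) — print's "`tr R(f′)`" on the convolution span;
* `AdelicGroupData.diagTrace_hasSum_tsum_inner_blocks` (+ `summable_inner_integratedOperator_block`, `summable_norm_tsum_inner_blocks`) —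
  **block form** `θ(F) = Σ_{W ∈ S} Σ_k ⟪R(h) e^W_k, R(g) e^W_k⟫` over every orthogonal decomposition `S` with dense span, blocks absolutely
  convergent and absolutely summable over `S` [Gelbart1975 (10.12)];
* `AdelicGroupData.diagTrace_hasSum_multiplicity_mul_tsum_inner` — **multiplicity form** `θ(F) = Σ_{c ∈ range q} m(rep c) · Σ_k ⟪R(h)
  e^{rep c}_k, R(g) e^{rep c}_k⟫` for `S` into irreducibles, `q` classifying unitary equivalence, `m = ContRepresentation.multiplicity`
  (finite, `multiplicity_toNat_coe`) — Rogawski's `Σ_{π′} m(π′) tr π′(f′)` [§14.5 p. 237] ∕ Gelbart's (10.14) polarised;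
* `UnitaryGroup.…` — the same for `θ_{G′} = UnitaryGroup.diagTrace L N H μ ν hanis`, `G′ = U(H)` anisotropic over a CM field.

NOT here: Dixmier–Malliavin ∕ trace class for a general smooth `f′` (everything is on the convolution span `{g ⋆ h^*}`).

## References

* J. Rogawski, *Automorphic Representations of Unitary Groups in Three Variables* (1990), §14.5 (print p. 237) [Rogawski1990].
* S. Gelbart, *Automorphic forms on adele groups*, Ann. of Math. Studies 83 (1975), (9.11), Lemma 10.6, (10.12)–(10.14) [Gelbart1975].
* M. Reed, B. Simon, *Methods of Modern Mathematical Physics I* (1972), Thm. VI.22 (e), Thm. VI.24 [ReedSimon1972].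
-/

noncomputable section

open MeasureTheory Measure Set Filter Topology CompactlySupported NumberField
open Literature.MeasureTheory.Group Literature.Analysis.OperatorTheory
open ContRepresentation
open scoped ENNReal NNReal InnerProductSpace ComplexConjugate

/-! ### Generic: the Hilbert–Schmidt pairing of a block is a class function -/

namespace ContRepresentation

variable {G H : Type*} [Group G] [TopologicalSpace G] [MeasurableSpace G] [OpensMeasurableSpace G]
  [NormedAddCommGroup H] [InnerProductSpace ℂ H] [CompleteSpace H] {π : ContRepresentation ℂ G H}

/-- **The Hilbert–Schmidt pairing of the blocks `π(g)|_W`, `π(h)|_W` depends only on the unitary equivalence class of `W`**: for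
unitary strongly continuous `π`, `g, h ∈ C_c(G)`, `W ≃ W′` unitarily, Hilbert bases `(e_k)` of `W`, `(e′_j)` of `W′` with `π(g)`, `π(h)`
Hilbert–Schmidt along `(e_k)`: `Σ_j ⟪π(h) e′_j, π(g) e′_j⟫ = Σ_k ⟪π(h) e_k, π(g) e_k⟫` (transport `(e_k)` along the unitary `e : W ≃ W′`, which
commutes with `π(f)` — `ClosedSubrep.map_integratedOperator_eq` — and preserves inner products; basis independence inside `W′`,
`tsum_inner_apply_apply_eq_of_hilbertBasis_of_mem`). [cite: Gelbart1975, Lemma 10.6 and (10.12)] [cite: ReedSimon1972, Thm. VI.24] -/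
theorem ClosedSubrep.tsum_inner_integratedOperator_eq_of_areUnitarilyEquivalent
    (hu : π.IsUnitary) (hc : π.IsStronglyContinuous) (η : Measure G) [IsFiniteMeasureOnCompacts η]
    (g h : C_c(G, ℂ)) {W W' : ClosedSubrep π}
    (he : AreUnitarilyEquivalent W.toContRep W'.toContRep)
    {ι ι' : Type*} (b : HilbertBasis ι ℂ W.toSubmodule) (b' : HilbertBasis ι' ℂ W'.toSubmodule)
    (hg : Summable fun k => ‖π.integratedOperator hu hc η g (b k)‖ ^ 2)
    (hh : Summable fun k => ‖π.integratedOperator hu hc η h (b k)‖ ^ 2) :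
    ∑' j, ⟪π.integratedOperator hu hc η h (b' j), π.integratedOperator hu hc η g (b' j)⟫_ℂ =
      ∑' k, ⟪π.integratedOperator hu hc η h (b k), π.integratedOperator hu hc η g (b k)⟫_ℂ := by
  obtain ⟨e, heiso⟩ := he
  -- `e` as a unitary `W ≃ W'`, and the transported basis `bU = e ∘ b` of `W'`
  let Ue : W.toSubmodule ≃ₗᵢ[ℂ] W'.toSubmodule :=
    { (e.toContinuousLinearEquiv : W.toSubmodule ≃L[ℂ] W'.toSubmodule).toLinearEquiv with
      norm_map' := fun v => heiso.norm_map_of_map_zero (map_zero e) v }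
  have hUe : ∀ v, Ue v = e v := fun v => rfl
  obtain ⟨bU, hbU⟩ := exists_hilbertBasis_map_linearIsometryEquiv b Ue
  -- termwise: `π(f) (e e_k) = e (π(f) e_k)`
  have hterm : ∀ (f : C_c(G, ℂ)) (k : ι), π.integratedOperator hu hc η f (bU k : H) =
      ((e ⟨π.integratedOperator hu hc η f (b k), integratedOperator_apply_mem hu hc η f W (b k).2⟩ : W'.toSubmodule) : H) := by
    intro f k
    rw [hbU k, hUe, ClosedSubrep.map_integratedOperator_eq hu hc η f e (b k)]
  have hnorm : ∀ (f : C_c(G, ℂ)) (k : ι), ‖π.integratedOperator hu hc η f (bU k : H)‖ = ‖π.integratedOperator hu hc η f (b k : H)‖ := by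
    intro f k
    rw [hterm f k, Submodule.norm_coe, heiso.norm_map_of_map_zero (map_zero e)]
    rfl
  rw [← tsum_inner_apply_apply_eq_of_hilbertBasis_of_mem bU b' (π.integratedOperator hu hc η h) (π.integratedOperator hu hc η g)
    (by simp_rw [hnorm h]; exact hh) (by simp_rw [hnorm g]; exact hg)]
  refine tsum_congr fun k => ?_
  rw [hterm h k, hterm g k, ← Submodule.coe_inner, ← hUe, ← hUe, Ue.inner_map_map, Submodule.coe_inner]

end ContRepresentation

namespace Literature.NumberTheory.Automorphic

/-! ### The diagonal trace: Hilbert–Schmidt summability along every basis, and `θ(F) = Tr R(F)` -/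

namespace AdelicGroupData

universe u

variable {K : Type} [Field K] [NumberField K] (𝒢 : AdelicGroupData.{u} K)
  (μ : Measure 𝒢.automorphicQuotient) [𝒢.IsAutomorphicMeasure μ]
  [LocallyCompactSpace 𝒢.Adelic] [SecondCountableTopology 𝒢.Adelic] [T2Space 𝒢.Adelic]
  [MeasurableSpace 𝒢.Adelic] [BorelSpace 𝒢.Adelic]
  [hH : IsClosed (𝒢.quotientSubgroup : Set 𝒢.Adelic)]
  (ρ : Measure 𝒢.quotientSubgroup) [ρ.IsMulLeftInvariant] [ρ.IsMulRightInvariant] [ρ.IsInvInvariant]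
  [IsFiniteMeasureOnCompacts ρ] [SFinite ρ]
  (ν : Measure 𝒢.Adelic) [IsHaarMeasure ν] [ν.IsInvInvariant]

/-- **`R(f)` is Hilbert–Schmidt along EVERY Hilbert basis of `L²(X, μ)`** (compact quotient; arbitrary index type — a Hilbert basis of
the separable `L²` is countable, `countable_of_hilbertBasis_L2`): `Σ_i ‖R(f) e_i‖² < ∞`. [cite: Gelbart1975, (9.11) and Lemma 10.6] -/
theorem summable_norm_sq_integratedOperator_rightRegular [CompactSpace 𝒢.automorphicQuotient] (hρ : ρ ≠ 0)
    (f : C_c(𝒢.Adelic, ℂ)) {ι : Type*} (b : HilbertBasis ι ℂ (𝒢.L2 μ)) :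
    Summable fun i => (‖(𝒢.rightRegular μ).integratedOperator (𝒢.isUnitary_rightRegular μ)
        (𝒢.isStronglyContinuous_rightRegular_holds μ) ν f (b i)‖ ^ 2 : ℝ) := by
  haveI : Countable ι := 𝒢.countable_of_hilbertBasis_L2 μ b
  obtain ⟨F, hF⟩ := exists_mulConv_mulStar_eq ν f
  exact (𝒢.diagTrace_hasSum_norm_sq μ ρ ν hρ f F hF b).summable

/-- **`Σ_i ‖R(f) v_i‖² < ∞` along every orthonormal FAMILY of `L²(X, μ)`** (e.g. a Hilbert basis of a closed invariant subspace):
orthonormal partial sums are dominated by the Hilbert–Schmidt sum. [cite: ReedSimon1972, Thm. VI.18] [cite: Gelbart1975, Lemma 10.6] -/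
theorem summable_norm_sq_integratedOperator_rightRegular_of_orthonormal [CompactSpace 𝒢.automorphicQuotient] (hρ : ρ ≠ 0)
    (f : C_c(𝒢.Adelic, ℂ)) {ι : Type*} {v : ι → 𝒢.L2 μ} (hv : Orthonormal ℂ v) :
    Summable fun i => (‖(𝒢.rightRegular μ).integratedOperator (𝒢.isUnitary_rightRegular μ)
        (𝒢.isStronglyContinuous_rightRegular_holds μ) ν f (v i)‖ ^ 2 : ℝ) := by
  obtain ⟨w, B, -, -⟩ := 𝒢.exists_countable_hilbertBasis_L2 μ
  exact (summable_norm_sq_apply_of_orthonormal B _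
    (𝒢.summable_norm_sq_integratedOperator_rightRegular μ ρ ν hρ f B) hv).1

/-- **`θ(g ⋆ h^*) = Σ_i ⟪R(h) e_i, R(g) e_i⟫` along every Hilbert basis** (arbitrary index type: `diagTrace_hasSum_inner` with the countability
of the basis supplied by separability). [cite: Gelbart1975, (9.11) and Lemma 10.6] [cite: Rogawski1990, §14.5 p. 237] -/
theorem diagTrace_hasSum_inner_of_hilbertBasis [CompactSpace 𝒢.automorphicQuotient] (hρ : ρ ≠ 0)
    (g h F : C_c(𝒢.Adelic, ℂ)) (hF : ∀ x, F x = mulConv ν (⇑g) (mulStar (⇑h)) x)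
    {ι : Type*} (b : HilbertBasis ι ℂ (𝒢.L2 μ)) :
    HasSum (fun i => ⟪(𝒢.rightRegular μ).integratedOperator (𝒢.isUnitary_rightRegular μ)
        (𝒢.isStronglyContinuous_rightRegular_holds μ) ν h (b i),
      (𝒢.rightRegular μ).integratedOperator (𝒢.isUnitary_rightRegular μ)
        (𝒢.isStronglyContinuous_rightRegular_holds μ) ν g (b i)⟫_ℂ) (𝒢.diagTrace μ ρ ν F) := by
  haveI : Countable ι := 𝒢.countable_of_hilbertBasis_L2 μ b
  exact 𝒢.diagTrace_hasSum_inner μ ρ ν hρ g h F hF b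

/-- **`θ(F) = Tr R(F)` literally, on the convolution span**: for `F = g ⋆ h^*` and EVERY Hilbert basis `(e_i)` of `L²(X, μ)`, `Σ_i ⟪e_i, R(F) e_i⟫`
converges to `θ(F)`. Indeed `R(F) = R(g) ∘ R(h^*) = R(g) ∘ R(h)^†` (`integratedOperator_comp_integratedOperator`, `adjoint_integratedOperator`), so
`⟪e_i, R(F) e_i⟫ = ⟪R(g)^† e_i, R(h)^† e_i⟫`, and the adjoint form of the Hilbert–Schmidt pairing (`hasSum_inner_apply_apply_and_adjoint`,
`Σ_i ⟪A e_i, B e_i⟫ = Σ_i ⟪B^† e_i, A^† e_i⟫`) turns `Σ_i ⟪R(h) e_i, R(g) e_i⟫ = θ(F)` into the claim — print's "`T_{G′}(f′)` is the trace of `ρ(f′)`"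
∕ "`tr R(f) = ∫ K(x, x) dx` … when `f = f₁ * f₂`". [cite: Rogawski1990, §14.5 p. 237] [cite: Gelbart1975, (9.11)] [cite: ReedSimon1972, Thm. VI.24] -/
theorem diagTrace_hasSum_inner_integratedOperator_self [CompactSpace 𝒢.automorphicQuotient] (hρ : ρ ≠ 0)
    (g h F : C_c(𝒢.Adelic, ℂ)) (hF : ∀ x, F x = mulConv ν (⇑g) (mulStar (⇑h)) x)
    {ι : Type*} (b : HilbertBasis ι ℂ (𝒢.L2 μ)) :
    HasSum (fun i => ⟪(b i : 𝒢.L2 μ), (𝒢.rightRegular μ).integratedOperator (𝒢.isUnitary_rightRegular μ)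
        (𝒢.isStronglyContinuous_rightRegular_holds μ) ν F (b i)⟫_ℂ) (𝒢.diagTrace μ ρ ν F) := by
  have hu := 𝒢.isUnitary_rightRegular μ
  have hc := 𝒢.isStronglyContinuous_rightRegular_holds μ
  -- `h^*` as an element of `C_c`, `R(h^*) = R(h)^†`, `R(F) = R(g) ∘ R(h^*)`
  obtain ⟨hs, hhs⟩ := exists_compactlySupported_mulStar h
  have hadj := ContRepresentation.adjoint_integratedOperator hu hc ν h hs hhs
  have hcomp := ContRepresentation.integratedOperator_comp_integratedOperator hu hc ν g hs F fun x => by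
    rw [hF x, show (⇑hs : 𝒢.Adelic → ℂ) = mulStar (⇑h) from funext hhs]
  -- the pairing and its adjoint form have the same sum `θ(F)`
  obtain ⟨s, h1, h2⟩ := hasSum_inner_apply_apply_and_adjoint b b
    ((𝒢.rightRegular μ).integratedOperator hu hc ν h) ((𝒢.rightRegular μ).integratedOperator hu hc ν g)
    (𝒢.summable_norm_sq_integratedOperator_rightRegular μ ρ ν hρ h b)
    (𝒢.summable_norm_sq_integratedOperator_rightRegular μ ρ ν hρ g b)
  have hs_eq : s = 𝒢.diagTrace μ ρ ν F := h1.unique (𝒢.diagTrace_hasSum_inner_of_hilbertBasis μ ρ ν hρ g h F hF b)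
  rw [← hs_eq]
  refine h2.congr_fun fun i => ?_
  -- `⟪e_i, R(F) e_i⟫ = ⟪e_i, R(g) (R(h)^† e_i)⟫ = ⟪R(g)^† e_i, R(h)^† e_i⟫`
  rw [ContinuousLinearMap.adjoint_inner_left, hadj, ← hcomp, ContinuousLinearMap.comp_apply]

/-! ### Block form: `θ(g ⋆ h^*) = Σ_{W ∈ S} Σ_k ⟪R(h) e^W_k, R(g) e^W_k⟫` -/

/-- Each block pairing `Σ_k ⟪R(h) e^W_k, R(g) e^W_k⟫` over a Hilbert basis of a closed invariant subspace `W` converges absolutely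
(the member basis is an orthonormal family of `L²`; `summable_inner_of_summable_norm_sq`). [cite: ReedSimon1972, Thm. VI.22 (e)]
[cite: Gelbart1975, (10.12)] -/
theorem summable_inner_integratedOperator_block [CompactSpace 𝒢.automorphicQuotient] (hρ : ρ ≠ 0)
    (g h : C_c(𝒢.Adelic, ℂ)) (W : ClosedSubrep (𝒢.rightRegular μ)) {κ : Type*} (b : HilbertBasis κ ℂ W.toSubmodule) :
    Summable fun k => ⟪(𝒢.rightRegular μ).integratedOperator (𝒢.isUnitary_rightRegular μ)
        (𝒢.isStronglyContinuous_rightRegular_holds μ) ν h (b k),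
      (𝒢.rightRegular μ).integratedOperator (𝒢.isUnitary_rightRegular μ)
        (𝒢.isStronglyContinuous_rightRegular_holds μ) ν g (b k)⟫_ℂ := by
  have hv : Orthonormal ℂ (fun k => (b k : 𝒢.L2 μ)) := W.toSubmodule.subtypeₗᵢ.orthonormal_comp_iff.mpr b.orthonormal
  exact summable_inner_of_summable_norm_sq
    (𝒢.summable_norm_sq_integratedOperator_rightRegular_of_orthonormal μ ρ ν hρ h hv)
    (𝒢.summable_norm_sq_integratedOperator_rightRegular_of_orthonormal μ ρ ν hρ g hv)

/-- **Block form of the χ-expansion** (Gelbart (10.12) polarised): for an orthogonal decomposition `S` of `L²(X, μ)` into closed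
invariant subspaces with dense span, Hilbert bases `(e^W_k)` of the members (arbitrary index types), `g, h ∈ C_c` and `F = g ⋆ h^*`:
**`θ(F) = Σ_{W ∈ S} Σ_k ⟪R(h) e^W_k, R(g) e^W_k⟫`** as a convergent series over `S`. Proof: the `e^W_k` together form a Hilbert basis of
`L²` (`exists_hilbertBasis_sigma`), along which `Σ ⟪R(h) e, R(g) e⟫ = θ(F)` (`diagTrace_hasSum_inner_of_hilbertBasis`); regroup by
members (`HasSum.sigma`, blocks summable by `summable_inner_integratedOperator_block`). [cite: Gelbart1975, (10.12)–(10.14)]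
[cite: Rogawski1990, §14.5 p. 237] -/
theorem diagTrace_hasSum_tsum_inner_blocks [CompactSpace 𝒢.automorphicQuotient] (hρ : ρ ≠ 0)
    (g h F : C_c(𝒢.Adelic, ℂ)) (hF : ∀ x, F x = mulConv ν (⇑g) (mulStar (⇑h)) x)
    {S : Set (ClosedSubrep (𝒢.rightRegular μ))}
    (horth : S.Pairwise fun W W' => W.toSubmodule ⟂ W'.toSubmodule) (hdense : ClosedSubrep.iSupClosure S = ⊤)
    {κ : S → Type*} (b : ∀ W : S, HilbertBasis (κ W) ℂ (W : ClosedSubrep (𝒢.rightRegular μ)).toSubmodule) :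
    HasSum (fun W : S => ∑' k, ⟪(𝒢.rightRegular μ).integratedOperator (𝒢.isUnitary_rightRegular μ)
        (𝒢.isStronglyContinuous_rightRegular_holds μ) ν h (b W k),
      (𝒢.rightRegular μ).integratedOperator (𝒢.isUnitary_rightRegular μ)
        (𝒢.isStronglyContinuous_rightRegular_holds μ) ν g (b W k)⟫_ℂ) (𝒢.diagTrace μ ρ ν F) := by
  have hV : OrthogonalFamily ℂ (fun W : S => (W : ClosedSubrep (𝒢.rightRegular μ)).toSubmodule)
      fun W => (W : ClosedSubrep (𝒢.rightRegular μ)).toSubmodule.subtypeₗᵢ :=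
    OrthogonalFamily.of_pairwise (ClosedSubrep.pairwise_subtype_isOrtho horth)
  obtain ⟨B, hB⟩ := exists_hilbertBasis_sigma hV (ClosedSubrep.orthogonal_iSup_eq_bot_of_iSupClosure_eq_top hdense) b
  have h1 := 𝒢.diagTrace_hasSum_inner_of_hilbertBasis μ ρ ν hρ g h F hF B
  simp only [hB] at h1
  exact h1.sigma fun W => (𝒢.summable_inner_integratedOperator_block μ ρ ν hρ g h W.1 (b W)).hasSum

/-- The blocks are ABSOLUTELY summable over `S`: `Σ_{W ∈ S} |Σ_k ⟪R(h) e^W_k, R(g) e^W_k⟫| ≤ ½ (Σ ‖R(h) e‖² + Σ ‖R(g) e‖²) < ∞`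
(`norm_tsum_inner_le` blockwise; the norm-square blocks are summable over `S` because their total is `θ(h ⋆ h^*) + θ(g ⋆ g^*)`).
[cite: ReedSimon1972, Thm. VI.22 (c), (e)] [cite: Gelbart1975, (10.12)] -/
theorem summable_norm_tsum_inner_blocks [CompactSpace 𝒢.automorphicQuotient] (hρ : ρ ≠ 0)
    (g h : C_c(𝒢.Adelic, ℂ)) {S : Set (ClosedSubrep (𝒢.rightRegular μ))}
    (horth : S.Pairwise fun W W' => W.toSubmodule ⟂ W'.toSubmodule) (hdense : ClosedSubrep.iSupClosure S = ⊤)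
    {κ : S → Type*} (b : ∀ W : S, HilbertBasis (κ W) ℂ (W : ClosedSubrep (𝒢.rightRegular μ)).toSubmodule) :
    Summable fun W : S => ‖∑' k, ⟪(𝒢.rightRegular μ).integratedOperator (𝒢.isUnitary_rightRegular μ)
        (𝒢.isStronglyContinuous_rightRegular_holds μ) ν h (b W k),
      (𝒢.rightRegular μ).integratedOperator (𝒢.isUnitary_rightRegular μ)
        (𝒢.isStronglyContinuous_rightRegular_holds μ) ν g (b W k)⟫_ℂ‖ := by
  have hu := 𝒢.isUnitary_rightRegular μ
  have hc := 𝒢.isStronglyContinuous_rightRegular_holds μ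
  have hV : OrthogonalFamily ℂ (fun W : S => (W : ClosedSubrep (𝒢.rightRegular μ)).toSubmodule)
      fun W => (W : ClosedSubrep (𝒢.rightRegular μ)).toSubmodule.subtypeₗᵢ :=
    OrthogonalFamily.of_pairwise (ClosedSubrep.pairwise_subtype_isOrtho horth)
  obtain ⟨B, hB⟩ := exists_hilbertBasis_sigma hV (ClosedSubrep.orthogonal_iSup_eq_bot_of_iSupClosure_eq_top hdense) b
  -- the norm-square families along the sigma basis, regrouped by members
  have hsq : ∀ f : C_c(𝒢.Adelic, ℂ), Summable fun W : S =>
      ∑' k, ‖(𝒢.rightRegular μ).integratedOperator hu hc ν f (b W k)‖ ^ 2 := by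
    intro f
    have h0 := 𝒢.summable_norm_sq_integratedOperator_rightRegular μ ρ ν hρ f B
    simp only [hB] at h0
    exact ((summable_sigma_of_nonneg (fun _ => sq_nonneg _)).1 h0).2
  refine Summable.of_nonneg_of_le (fun _ => norm_nonneg _) (fun W => ?_) (((hsq h).add (hsq g)).div_const 2)
  have hv : Orthonormal ℂ (fun k => (b W k : 𝒢.L2 μ)) :=
    (W : ClosedSubrep (𝒢.rightRegular μ)).toSubmodule.subtypeₗᵢ.orthonormal_comp_iff.mpr (b W).orthonormal
  have hh' := 𝒢.summable_norm_sq_integratedOperator_rightRegular_of_orthonormal μ ρ ν hρ h hv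
  have hg' := 𝒢.summable_norm_sq_integratedOperator_rightRegular_of_orthonormal μ ρ ν hρ g hv
  exact (norm_tsum_inner_le (𝕜 := ℂ) hh' hg').trans (tsum_norm_mul_norm_le hh' hg')

/-! ### Multiplicity form: `θ(g ⋆ h^*) = Σ_{[π]} m(π) Tr(π(g) π(h)^*)` -/

omit [T2Space 𝒢.Adelic] [MeasurableSpace 𝒢.Adelic] [BorelSpace 𝒢.Adelic] hH in
/-- On a compact quotient every member `W` of an orthogonal decomposition into irreducibles has FINITE multiplicity, so the
natural-number cast of `(multiplicity W).toNat` is the multiplicity (`multiplicity_lt_top_of_compactSpace`).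
[cite: DeitmarEchterhoff2014, Thm. 9.2.2] -/
theorem multiplicity_toNat_coe [CompactSpace 𝒢.automorphicQuotient] (W : ClosedSubrep (𝒢.rightRegular μ))
    (hW : W.toContRep.IsTopIrreducible) :
    ((((𝒢.rightRegular μ).multiplicity W.toContRep).toNat : ℕ) : ℕ∞) = (𝒢.rightRegular μ).multiplicity W.toContRep :=
  ENat.coe_toNat (𝒢.multiplicity_lt_top_of_compactSpace μ W (ClosedSubrep.ne_bot_of_isTopIrreducible hW)).ne

/-- **The χ-expansion `θ(g ⋆ h^*) = Σ_{[π]} m(π) · Σ_k ⟪π(h) e_k, π(g) e_k⟫`** (Rogawski (1990), §14.5: "`T_{G′}(f′) = Σ_{π′} m(π′) tr π′(f′)`";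
Gelbart (1975), (10.14) `tr R(f ⋆ f^*) = Σ_π m(π) tr π(f) π(f)^*`, polarised). For an orthogonal decomposition `S` of `L²(X, μ)` into irreducibles
with dense span, member bases `(e^W_k)`, `q : S → Λ` CLASSIFYING unitary equivalence (`q W = q W′ ↔ W ≃ W′`), representatives `rep` of the
classes `c ∈ range q`, `g, h ∈ C_c` and `F = g ⋆ h^*`: **`θ(F) = Σ_{c ∈ range q} m(rep c) · Σ_k ⟪R(h) e^{rep c}_k, R(g) e^{rep c}_k⟫`** as a convergent
series, `m = ContRepresentation.multiplicity` (finite, `multiplicity_toNat_coe`); the class term is independent of representative and basis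
(`ClosedSubrep.tsum_inner_integratedOperator_eq_of_areUnitarilyEquivalent`), `m(rep c) = #q⁻¹(c)` (`IsUnitary.multiplicity_eq_card_of_set`); the
block series `diagTrace_hasSum_tsum_inner_blocks` is regrouped along the fibres of `q`. [cite: Rogawski1990, §14.5 p. 237] [cite: Gelbart1975, (10.14)] -/
theorem diagTrace_hasSum_multiplicity_mul_tsum_inner [CompactSpace 𝒢.automorphicQuotient] (hρ : ρ ≠ 0)
    (g h F : C_c(𝒢.Adelic, ℂ)) (hF : ∀ x, F x = mulConv ν (⇑g) (mulStar (⇑h)) x)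
    {S : Set (ClosedSubrep (𝒢.rightRegular μ))} (hirr : ∀ W ∈ S, W.toContRep.IsTopIrreducible)
    (horth : S.Pairwise fun W W' => W.toSubmodule ⟂ W'.toSubmodule) (hdense : ClosedSubrep.iSupClosure S = ⊤)
    {κ : S → Type*} (b : ∀ W : S, HilbertBasis (κ W) ℂ (W : ClosedSubrep (𝒢.rightRegular μ)).toSubmodule)
    {Λ : Type*} (q : S → Λ)
    (hq : ∀ W W' : S, q W = q W' ↔ AreUnitarilyEquivalent (W : ClosedSubrep (𝒢.rightRegular μ)).toContRep
      (W' : ClosedSubrep (𝒢.rightRegular μ)).toContRep)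
    (rep : Set.range q → S) (hrep : ∀ c, q (rep c) = c) :
    HasSum (fun c : Set.range q =>
      ((((𝒢.rightRegular μ).multiplicity (rep c : ClosedSubrep (𝒢.rightRegular μ)).toContRep).toNat : ℕ) : ℂ) *
        ∑' k, ⟪(𝒢.rightRegular μ).integratedOperator (𝒢.isUnitary_rightRegular μ)
            (𝒢.isStronglyContinuous_rightRegular_holds μ) ν h (b (rep c) k),
          (𝒢.rightRegular μ).integratedOperator (𝒢.isUnitary_rightRegular μ)
            (𝒢.isStronglyContinuous_rightRegular_holds μ) ν g (b (rep c) k)⟫_ℂ) (𝒢.diagTrace μ ρ ν F) := by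
  have hu := 𝒢.isUnitary_rightRegular μ
  have hc := 𝒢.isStronglyContinuous_rightRegular_holds μ
  -- the block terms `a W`, their series regrouped along the fibres of `q`
  set a : S → ℂ := fun W => ∑' k, ⟪(𝒢.rightRegular μ).integratedOperator hu hc ν h (b W k),
      (𝒢.rightRegular μ).integratedOperator hu hc ν g (b W k)⟫_ℂ with ha
  have hfib : HasSum (fun c : Λ => ∑' W : q ⁻¹' {c}, a W) (𝒢.diagTrace μ ρ ν F) :=
    (𝒢.diagTrace_hasSum_tsum_inner_blocks μ ρ ν hρ g h F hF horth hdense b).tsum_fiberwise q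
  -- the class term is a class function
  have hclass : ∀ W W' : S, q W = q W' → a W = a W' := by
    intro W W' hWW'
    have hv : Orthonormal ℂ (fun k => (b W' k : 𝒢.L2 μ)) :=
      (W' : ClosedSubrep (𝒢.rightRegular μ)).toSubmodule.subtypeₗᵢ.orthonormal_comp_iff.mpr (b W').orthonormal
    exact ClosedSubrep.tsum_inner_integratedOperator_eq_of_areUnitarilyEquivalent hu hc ν g h ((hq W W').1 hWW').symm (b W') (b W)
      (𝒢.summable_norm_sq_integratedOperator_rightRegular_of_orthonormal μ ρ ν hρ g hv)
      (𝒢.summable_norm_sq_integratedOperator_rightRegular_of_orthonormal μ ρ ν hρ h hv)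
  -- the terms outside `range q` vanish
  have hsupp : (Function.support fun c : Λ => ∑' W : q ⁻¹' {c}, a W) ⊆ Set.range q := by
    intro c hc0
    by_contra hc'
    haveI : IsEmpty (q ⁻¹' {c}) := ⟨fun W => hc' ⟨W.1, W.2⟩⟩
    exact hc0 tsum_empty
  refine ((hasSum_subtype_iff_of_support_subset hsupp).2 hfib).congr_fun fun c => ?_
  -- a fibre over `c ∈ range q` has `#q⁻¹(c) = m(rep c)` members, each contributing `a (rep c)`
  change _ = ∑' W : q ⁻¹' {(c : Λ)}, a W
  have hconst : ∀ W : q ⁻¹' {(c : Λ)}, a W = a (rep c) := fun W => hclass W.1 (rep c) (by rw [hrep c]; exact W.2)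
  rw [tsum_congr hconst, tsum_const, nsmul_eq_mul]
  congr 2
  have hset : q ⁻¹' {(c : Λ)} = {W : S | AreUnitarilyEquivalent (W : ClosedSubrep (𝒢.rightRegular μ)).toContRep
      (rep c : ClosedSubrep (𝒢.rightRegular μ)).toContRep} := by
    ext W
    rw [Set.mem_preimage, Set.mem_singleton_iff, Set.mem_setOf_eq, ← hq W (rep c), hrep c]
  have hcard := hu.multiplicity_eq_card_of_set hirr horth hdense (rep c : ClosedSubrep (𝒢.rightRegular μ)).toContRep
  have hfin : Finite {W : S // AreUnitarilyEquivalent (W : ClosedSubrep (𝒢.rightRegular μ)).toContRep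
      (rep c : ClosedSubrep (𝒢.rightRegular μ)).toContRep} := by
    rw [← ENat.card_lt_top, ← hcard]
    exact 𝒢.multiplicity_lt_top_of_compactSpace μ _ (ClosedSubrep.ne_bot_of_isTopIrreducible (hirr _ (rep c).2))
  rw [ENat.card_eq_coe_natCard] at hcard
  rw [hcard, ENat.toNat_coe]
  exact Nat.card_congr (Equiv.setCongr hset.symm)

end AdelicGroupData

/-! ### The unitary group of an anisotropic hermitian matrix over a CM field -/

namespace UnitaryGroup

open Literature.AlgebraicGeometry.ShimuraVarieties (hermForm)

variable (L : Type) [Field L] [NumberField L] [IsCMField L] (N : ℕ) (H : Matrix (Fin N) (Fin N) L)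
  [MeasurableSpace (cmDatum L N H).Adelic] [BorelSpace (cmDatum L N H).Adelic]
  (μ : Measure (cmDatum L N H).automorphicQuotient) [(cmDatum L N H).IsAutomorphicMeasure μ]
  (ν : Measure (cmDatum L N H).Adelic) [ν.IsHaarMeasure] [ν.IsInvInvariant]

/-- **`θ_{G′}(F′) = Tr R(F′)` for the inner form `G′ = U(H)`, `H` anisotropic**: for `F′ = g ⋆ h^*` and every Hilbert basis `(e_i)` of
`L²(U(H)(L⁺)∖U(H)(𝔸_{L⁺}), μ)`, `Σ_i ⟪e_i, R(F′) e_i⟫ = UnitaryGroup.diagTrace L N H μ ν hanis F′` — "the trace of `ρ(f′)` on `L(G′)`".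
[cite: Rogawski1990, §14.5 p. 237] [cite: Gelbart1975, (9.11)] -/
theorem diagTrace_hasSum_inner_integratedOperator_self (hanis : ∀ x : Fin N → L, hermForm (cmConjRingHom L) H x x = 0 → x = 0)
    (g h F : C_c((cmDatum L N H).Adelic, ℂ)) (hF : ∀ x, F x = mulConv ν (⇑g) (mulStar (⇑h)) x)
    {ι : Type*} (b : HilbertBasis ι ℂ ((cmDatum L N H).L2 μ)) :
    HasSum (fun i => ⟪(b i : (cmDatum L N H).L2 μ), ((cmDatum L N H).rightRegular μ).integratedOperator
        ((cmDatum L N H).isUnitary_rightRegular μ) ((cmDatum L N H).isStronglyContinuous_rightRegular_holds μ) ν F (b i)⟫_ℂ)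
      (diagTrace L N H μ ν hanis F) := by
  haveI := compactSpace_cmDatum_automorphicQuotient L N H hanis
  haveI := isClosed_cmDatum_quotientSubgroup L N H
  haveI := countable_cmDatum_quotientSubgroup L N H
  haveI := isFiniteMeasureOnCompacts_count_cmDatum_quotientSubgroup L N H
  exact AdelicGroupData.diagTrace_hasSum_inner_integratedOperator_self (cmDatum L N H) μ Measure.count ν (NeZero.ne _) g h F hF b

/-- **Block form for `θ_{G′}`**, `G′ = U(H)` anisotropic: for every orthogonal decomposition `S` of `L²` with dense span and member
bases, `θ_{G′}(g ⋆ h^*) = Σ_{W ∈ S} Σ_k ⟪R(h) e^W_k, R(g) e^W_k⟫`. [cite: Rogawski1990, §14.5 p. 237] [cite: Gelbart1975, (10.12)] -/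
theorem diagTrace_hasSum_tsum_inner_blocks (hanis : ∀ x : Fin N → L, hermForm (cmConjRingHom L) H x x = 0 → x = 0)
    (g h F : C_c((cmDatum L N H).Adelic, ℂ)) (hF : ∀ x, F x = mulConv ν (⇑g) (mulStar (⇑h)) x)
    {S : Set (ClosedSubrep ((cmDatum L N H).rightRegular μ))}
    (horth : S.Pairwise fun W W' => W.toSubmodule ⟂ W'.toSubmodule) (hdense : ClosedSubrep.iSupClosure S = ⊤)
    {κ : S → Type*} (b : ∀ W : S, HilbertBasis (κ W) ℂ (W : ClosedSubrep ((cmDatum L N H).rightRegular μ)).toSubmodule) :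
    HasSum (fun W : S => ∑' k, ⟪((cmDatum L N H).rightRegular μ).integratedOperator ((cmDatum L N H).isUnitary_rightRegular μ)
        ((cmDatum L N H).isStronglyContinuous_rightRegular_holds μ) ν h (b W k),
      ((cmDatum L N H).rightRegular μ).integratedOperator ((cmDatum L N H).isUnitary_rightRegular μ)
        ((cmDatum L N H).isStronglyContinuous_rightRegular_holds μ) ν g (b W k)⟫_ℂ) (diagTrace L N H μ ν hanis F) := by
  haveI := compactSpace_cmDatum_automorphicQuotient L N H hanis
  haveI := isClosed_cmDatum_quotientSubgroup L N H
  haveI := countable_cmDatum_quotientSubgroup L N H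
  haveI := isFiniteMeasureOnCompacts_count_cmDatum_quotientSubgroup L N H
  exact AdelicGroupData.diagTrace_hasSum_tsum_inner_blocks (cmDatum L N H) μ Measure.count ν (NeZero.ne _) g h F hF horth hdense b

/-- **`θ_{G′}(g ⋆ h^*) = Σ_{[π′]} m(π′) · Σ_k ⟪π′(h) e_k, π′(g) e_k⟫` for the anisotropic inner form `G′ = U(H)`** — Rogawski (1990), §14.5:
"`T_{G′}(f′) = Σ_{π′} m(π′) tr π′(f′)`", in the tree's Hilbert–Schmidt currency and as complex numbers: for every orthogonal decomposition
`S` of `L²(U(H)(L⁺)∖U(H)(𝔸_{L⁺}), μ)` into irreducibles, classifying map `q`, representatives `rep` and member bases `b`,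
`HasSum (c ↦ m(rep c) · Σ_k ⟪R(h) e^{rep c}_k, R(g) e^{rep c}_k⟫) (θ_{G′}(F′))`, `m = ContRepresentation.multiplicity` (finite).
[cite: Rogawski1990, §14.5 p. 237] [cite: Gelbart1975, (10.14)] -/
theorem diagTrace_hasSum_multiplicity_mul_tsum_inner (hanis : ∀ x : Fin N → L, hermForm (cmConjRingHom L) H x x = 0 → x = 0)
    (g h F : C_c((cmDatum L N H).Adelic, ℂ)) (hF : ∀ x, F x = mulConv ν (⇑g) (mulStar (⇑h)) x)
    {S : Set (ClosedSubrep ((cmDatum L N H).rightRegular μ))} (hirr : ∀ W ∈ S, W.toContRep.IsTopIrreducible)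
    (horth : S.Pairwise fun W W' => W.toSubmodule ⟂ W'.toSubmodule) (hdense : ClosedSubrep.iSupClosure S = ⊤)
    {κ : S → Type*} (b : ∀ W : S, HilbertBasis (κ W) ℂ (W : ClosedSubrep ((cmDatum L N H).rightRegular μ)).toSubmodule)
    {Λ : Type*} (q : S → Λ)
    (hq : ∀ W W' : S, q W = q W' ↔ AreUnitarilyEquivalent (W : ClosedSubrep ((cmDatum L N H).rightRegular μ)).toContRep
      (W' : ClosedSubrep ((cmDatum L N H).rightRegular μ)).toContRep)
    (rep : Set.range q → S) (hrep : ∀ c, q (rep c) = c) :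
    HasSum (fun c : Set.range q =>
      (((((cmDatum L N H).rightRegular μ).multiplicity (rep c : ClosedSubrep ((cmDatum L N H).rightRegular μ)).toContRep).toNat : ℕ) : ℂ) *
        ∑' k, ⟪((cmDatum L N H).rightRegular μ).integratedOperator ((cmDatum L N H).isUnitary_rightRegular μ)
            ((cmDatum L N H).isStronglyContinuous_rightRegular_holds μ) ν h (b (rep c) k),
          ((cmDatum L N H).rightRegular μ).integratedOperator ((cmDatum L N H).isUnitary_rightRegular μ)
            ((cmDatum L N H).isStronglyContinuous_rightRegular_holds μ) ν g (b (rep c) k)⟫_ℂ)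
      (diagTrace L N H μ ν hanis F) := by
  haveI := compactSpace_cmDatum_automorphicQuotient L N H hanis
  haveI := isClosed_cmDatum_quotientSubgroup L N H
  haveI := countable_cmDatum_quotientSubgroup L N H
  haveI := isFiniteMeasureOnCompacts_count_cmDatum_quotientSubgroup L N H
  exact AdelicGroupData.diagTrace_hasSum_multiplicity_mul_tsum_inner (cmDatum L N H) μ Measure.count ν (NeZero.ne _) g h F hF
    hirr horth hdense b q hq rep hrep

omit [MeasurableSpace (cmDatum L N H).Adelic] [BorelSpace (cmDatum L N H).Adelic] in
/-- Finite multiplicities for the inner form: `((m(W)).toNat : ℕ∞) = m(W)` for every irreducible closed invariant `W ≤ L²` — the shape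
of the line's `mult` pin `((mult P : ℕ) : ℕ∞) = multiplicity P.space.toContRep`. [cite: Rogawski1990, §14.5 p. 237]
[cite: DeitmarEchterhoff2014, Thm. 9.2.2] -/
theorem multiplicity_toNat_coe (hanis : ∀ x : Fin N → L, hermForm (cmConjRingHom L) H x x = 0 → x = 0)
    (W : ClosedSubrep ((cmDatum L N H).rightRegular μ)) (hW : W.toContRep.IsTopIrreducible) :
    (((((cmDatum L N H).rightRegular μ).multiplicity W.toContRep).toNat : ℕ) : ℕ∞) =
      ((cmDatum L N H).rightRegular μ).multiplicity W.toContRep := by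
  haveI := compactSpace_cmDatum_automorphicQuotient L N H hanis
  exact AdelicGroupData.multiplicity_toNat_coe (cmDatum L N H) μ W hW

end UnitaryGroup

end Literature.NumberTheory.Automorphic
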